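import Summits.BirchSwinnertonDyer.BirchSwinnertonDyer.Theorems.SignedLowerHalvesKobayashiMainConjectureSmallImageSelfTwistRecordsThree
import Summits.BirchSwinnertonDyer.Rank1Residual.X9.GaloisShear
import Literature.NumberTheory.EllipticCurves.QuadraticTwistFramedTorsion
import Literature.NumberTheory.EllipticCurves.Rank1Residual.GVParityTwistProofs
import Literature.NumberTheory.EllipticCurves.ComplexMultiplicationHasCMProofs
import HarnessLib

/-!
# Route `SignedLowerHalves`, crux `KobayashiMainConjectureSmallImage` (item stmt-BirchSwinnertonDyer-19002) —
# «SELF-TWIST ⟹ NOT SURJECTIVE»: a kernel certificate for the image datum `¬ Surj W 3` of the newform-partnered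
# item-4 pairs @ 3 (cell `bsd-ssimc`, seat `bsd-ssimc-k3-c4` gen 14, object «L4X-REKEY-NF» part F1;
# `--supports stmt-BirchSwinnertonDyer-19002 --as helper`; theorems only)

HONEST FRAMING: Kobayashi's signed main conjecture at a non-surjective image is OPEN as a class statement;
item 4 stays OPEN; nothing here is booked; BSD is not proved by any of this.  This file proves a STRUCTURE
lemma and eleven per-pair corollaries; no main-conjecture claim is made here.

* `not_hasSurjectiveModNGaloisRep_three_of_selfTwist` — **class lemma.**  `W/ℚ` elliptic, `d ∈ ℚ^×` with SOME
  `σ₀ ∈ Γ_ℚ` negating `√d`, and a `Γ_ℚ`-EQUIVARIANT `e : E^{(d)}[3] ≃+ E[3]` (`E^{(d)} = W.quadraticTwist d`)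
  ⟹ `ρ̄_{E,3} : Γ_ℚ → Aut E[3]` is NOT onto.  Proof (Serre: a self-twist lies in a Cartan normaliser; run as
  the shear argument of the tree's `GaloisImage.J1728NotSurjThree`): with the untwisting `f : E^{(d)}(ℚ̄) ≃+ E(ℚ̄)`,
  `f(σP) = χ_d(σ)·σf(P)` (`exists_addEquiv_geomPoints_quadraticTwist_sqrt`, Silverman X.5.4), `φ := f ∘ e⁻¹ ∈
  Aut E[3]` satisfies `φ(σP) = χ_d(σ)·σφ(P)`.  An onto `ρ̄` gives every `ℤ/3`-frame `(P, Q)` a Galois SHEAR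
  `σP = P`, `σQ = P + Q` (`X9.exists_smul_eq_shear_of_hasSurjectiveModNGaloisRep`); with `φP = aP + bQ` the
  relation at `P` reads `aP + bQ = ±((a+b)P + bQ)`, forcing `b = 0` (`+`) or `P = 0` (`−`); so `φP = a·P` on every
  line with `a` constant on frames, and at `σ₀` (`χ_d(σ₀) = −1`, `R = σ₀P`): `φR = −a·R = a·R`, `R = 0` — absurd.
* `…_of_neg` — the same for `d < 0` (complex conjugation negates `√d`).
* §3: `not_surj_three_c<label>` for the eleven newform-partnered item-4 pairs @ 3, each from the landed kernel
  self-twist certificate `selfTwistThree_c<label>` (seat gen 10, p512219; Fisher's Hesse pencil) with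
  `d = d_K ∈ {−91, −148, −139, −52, −31}` — discharging the image binder `hns` of lane B's partner-free doors
  (`SmallImageSignedMuTransfer.kobayashiMainConjecture_of_signedMuAn_of_bsdp_of_analyticRank_eq_zero`, p532179)
  IN THE KERNEL; no Cremona image label is displayed.

PARTITION (cell bsd-ssimc): X7 (A7) × item 4's eleven newform-partnered pairs @ 3 — types-the-object-of (the
image datum `¬ Surj`); closes NONE; 0 census moves.  References: [Serre1972] §4.5, §4; [SilvermanAEC2009] X.5
Cor. 5.4, III.6.4(b); [Fisher2012Hessian] Thm. 13.2; [Cremona2006] Table 1; tree: `GaloisImage.J1728NotSurjThree`,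
`X9.GaloisShear`, `QuadraticTwistFramedTorsion`, `…SmallImageSelfTwistRecordsThree` (p512219). Memo: `HOME/k3c4-MEMO-13.md`.
-/

set_option autoImplicit false
set_option linter.dupNamespace false

noncomputable section

open scoped Classical
open WeierstrassCurve Field Literature.NumberTheory.EllipticCurves
  Literature.NumberTheory.GaloisRepresentations

namespace Summit.BirchSwinnertonDyer.BirchSwinnertonDyer.Theorems.SmallImageSelfTwist

/-! ### §1 Arithmetic in an abelian group of exponent `3` -/

section Exponent

variable {V : Type*} [AddCommGroup V]

/-- In exponent `3`, `2x = 0 ⟹ x = 0` (`x = 3x − 2x`). [folklore] -/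
theorem eq_zero_of_two_nsmul_eq_zero {x : V} (h3 : 3 • x = 0) (h : 2 • x = 0) : x = 0 := by
  have h' : x = 3 • x - 2 • x := eq_sub_of_add_eq' (succ_nsmul x 2).symm
  rw [h', h3, h, sub_zero]

/-- In exponent `3`, `x = −x ⟹ x = 0`. [folklore] -/
theorem eq_zero_of_eq_neg {x : V} (h3 : 3 • x = 0) (h : x = -x) : x = 0 := by
  apply eq_zero_of_two_nsmul_eq_zero h3
  rw [two_nsmul]
  nth_rewrite 2 [h]
  exact add_neg_cancel x

/-- In exponent `3`, `−x = 2x`. [folklore] -/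
theorem neg_eq_two_nsmul {x : V} (h3 : 3 • x = 0) : -x = 2 • x := by
  have h' : 2 • x + x = 0 := by rw [← succ_nsmul]; exact h3
  exact neg_eq_of_add_eq_zero_left h'

/-- In exponent `3`, a non-zero scalar of `ℤ/3` does not kill a non-zero element. [folklore] -/
theorem val_nsmul_ne_zero {x : V} (h3 : 3 • x = 0) (hx : x ≠ 0) {a : ZMod 3} (ha : a ≠ 0) :
    a.val • x ≠ 0 := by
  have ha' : a = 1 ∨ a = 2 := by revert a; decide
  rcases ha' with rfl | rfl
  · rw [show (1 : ZMod 3).val = 1 from rfl, one_nsmul]; exact hx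
  · rw [show (2 : ZMod 3).val = 2 from rfl]
    exact fun h ↦ hx (eq_zero_of_two_nsmul_eq_zero h3 h)

/-- **Frames from a point off a line.**  In exponent `3`: if `P ≠ 0` and `Q ∉ {0, P, 2P}`, then
`aP + bQ = 0` with `a, b < 3` forces `a = b = 0`. [folklore] -/
theorem frame_eq_zero_of_not_mem_line {P Q : V} (hP3 : 3 • P = 0) (hQ3 : 3 • Q = 0) (hP : P ≠ 0)
    (hQ0 : Q ≠ 0) (hQ1 : Q ≠ P) (hQ2 : Q ≠ 2 • P) {a b : ℕ} (ha : a < 3) (hb : b < 3)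
    (h : a • P + b • Q = 0) : a = 0 ∧ b = 0 := by
  have hnegP : -P = 2 • P := neg_eq_two_nsmul hP3
  have hnegQ : -Q = 2 • Q := neg_eq_two_nsmul hQ3
  interval_cases a <;> interval_cases b
  · exact ⟨rfl, rfl⟩
  · exfalso; rw [zero_nsmul, zero_add, one_nsmul] at h; exact hQ0 h
  · exfalso; rw [zero_nsmul, zero_add] at h; exact hQ0 (eq_zero_of_two_nsmul_eq_zero hQ3 h)
  · exfalso; rw [one_nsmul, zero_nsmul, add_zero] at h; exact hP h
  · exfalso; rw [one_nsmul, one_nsmul] at h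
    exact hQ2 (by rw [← hnegP]; exact (neg_eq_of_add_eq_zero_right h).symm)
  · exfalso; rw [one_nsmul] at h
    have h' : P = -(2 • Q) := eq_neg_of_add_eq_zero_left h
    rw [← hnegQ, neg_neg] at h'
    exact hQ1 h'.symm
  · exfalso; rw [zero_nsmul, add_zero] at h; exact hP (eq_zero_of_two_nsmul_eq_zero hP3 h)
  · exfalso; rw [one_nsmul] at h
    have h' : Q = -(2 • P) := eq_neg_of_add_eq_zero_right h
    rw [← hnegP, neg_neg] at h'
    exact hQ1 h'
  · exfalso; rw [← nsmul_add] at h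
    have hPQ3 : 3 • (P + Q) = 0 := by rw [nsmul_add, hP3, hQ3, add_zero]
    have h' : P + Q = 0 := eq_zero_of_two_nsmul_eq_zero hPQ3 h
    exact hQ2 (by rw [← hnegP]; exact (neg_eq_of_add_eq_zero_right h').symm)

end Exponent

/-! ### §2 The class lemma: an equivariant self-twist `E^{(d)}[3] ≅ E[3]` obstructs surjectivity -/

/-- **An equivariant self-twist `E^{(d)}[3] ≃+ E[3]` with `d` a non-square makes `ρ̄_{E,3}` NOT surjective.**
For an elliptic `W/ℚ`, `d ≠ 0` such that some `σ₀ ∈ Γ_ℚ` negates `√d`, and a `Γ_ℚ`-equivariant additive isomorphism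
`e : E^{(d)}[3] ≃+ E[3]`: `¬ W.HasSurjectiveModNGaloisRep 3` (shear argument of the module docstring; classically the
image lies in the normaliser of a Cartan subgroup of `GL₂(𝔽₃)`).
[cite: Serre1972, §4.5 (self-twists and Cartan normalisers) and §4 (framed E[p])] [cite: SilvermanAEC2009, X.5 Cor. 5.4 and III.6.4(b)] -/
theorem not_hasSurjectiveModNGaloisRep_three_of_selfTwist (W : WeierstrassCurve ℚ) [W.IsElliptic]
    {d : ℚ} (hd : d ≠ 0) (hσ₀ : ∃ σ₀ : absoluteGaloisGroup ℚ, σ₀ • geomSqrt d = -geomSqrt d)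
    (he : ∃ e : geomTorsion (W.quadraticTwist d) ((3 : ℕ) : ℤ) ≃+ geomTorsion W ((3 : ℕ) : ℤ),
      ∀ (σ : absoluteGaloisGroup ℚ) (Q : geomTorsion (W.quadraticTwist d) ((3 : ℕ) : ℤ)),
        e (σ • Q) = σ • e Q) :
    ¬ W.HasSurjectiveModNGaloisRep ((3 : ℕ) : ℤ) := by
  intro hsurj
  obtain ⟨σ₀, hσ₀⟩ := hσ₀
  obtain ⟨e, he⟩ := he
  haveI : NeZero (2 : ℚ) := ⟨by norm_num⟩
  obtain ⟨f, hf⟩ := W.exists_addEquiv_geomPoints_quadraticTwist_sqrt hd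
  have htor : ∀ {P : geomPoints (W.quadraticTwist d)},
      P ∈ geomTorsion (W.quadraticTwist d) ((3 : ℕ) : ℤ) ↔ f P ∈ geomTorsion W ((3 : ℕ) : ℤ) := by
    intro P
    rw [geomTorsion, geomTorsion, AddSubgroup.torsionBy.nsmul_iff, AddSubgroup.torsionBy.nsmul_iff,
      ← map_nsmul, AddEquiv.map_eq_zero_iff]
  let f₃ : geomTorsion (W.quadraticTwist d) ((3 : ℕ) : ℤ) ≃+ geomTorsion W ((3 : ℕ) : ℤ) :=
    { toFun := fun P ↦ ⟨f P, htor.mp P.2⟩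
      invFun := fun Q ↦ ⟨f.symm Q, by rw [htor, f.apply_symm_apply]; exact Q.2⟩
      left_inv := fun P ↦ Subtype.ext (f.symm_apply_apply _)
      right_inv := fun Q ↦ Subtype.ext (f.apply_symm_apply _)
      map_add' := fun P Q ↦ Subtype.ext (by
        change f ((P : geomPoints (W.quadraticTwist d)) + Q) = f P + f Q
        exact map_add f _ _) }
  have hf₃_coe : ∀ P : geomTorsion (W.quadraticTwist d) ((3 : ℕ) : ℤ),
      ((f₃ P : geomTorsion W ((3 : ℕ) : ℤ)) : geomPoints W) = f P := fun _ ↦ rfl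
  -- `φ := f₃ ∘ e⁻¹ ∈ Aut E[3]` with `φ(σQ) = χ_d(σ) σ φ(Q)`
  let φ : geomTorsion W ((3 : ℕ) : ℤ) ≃+ geomTorsion W ((3 : ℕ) : ℤ) := e.symm.trans f₃
  have he' : ∀ (σ : absoluteGaloisGroup ℚ) (Q : geomTorsion W ((3 : ℕ) : ℤ)), e.symm (σ • Q) = σ • e.symm Q := by
    intro σ Q
    apply e.injective
    rw [e.apply_symm_apply, he, e.apply_symm_apply]
  have hφ_pos : ∀ (σ : absoluteGaloisGroup ℚ), σ • geomSqrt d = geomSqrt d →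
      ∀ Q : geomTorsion W ((3 : ℕ) : ℤ), φ (σ • Q) = σ • φ Q := by
    intro σ hσ Q
    change f₃ (e.symm (σ • Q)) = σ • f₃ (e.symm Q)
    rw [he']
    exact Subtype.ext (by
      rw [AddSubgroup.torsionBy.coe_smul, hf₃_coe, hf₃_coe, AddSubgroup.torsionBy.coe_smul,
        (hf σ).1 hσ])
  have hφ_neg : ∀ (σ : absoluteGaloisGroup ℚ), σ • geomSqrt d = -geomSqrt d →
      ∀ Q : geomTorsion W ((3 : ℕ) : ℤ), φ (σ • Q) = -(σ • φ Q) := by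
    intro σ hσ Q
    change f₃ (e.symm (σ • Q)) = -(σ • f₃ (e.symm Q))
    rw [he']
    exact Subtype.ext (by
      rw [AddSubgroup.coe_neg, AddSubgroup.torsionBy.coe_smul, hf₃_coe, hf₃_coe,
        AddSubgroup.torsionBy.coe_smul, (hf σ).2 hσ])
  have hφ : ∀ (σ : absoluteGaloisGroup ℚ) (Q : geomTorsion W ((3 : ℕ) : ℤ)), φ (σ • Q) = σ • φ Q ∨ φ (σ • Q) = -(σ • φ Q) := by
    intro σ Q
    rcases smul_geomSqrt_eq_or σ d with hσ | hσ
    · exact Or.inl (hφ_pos σ hσ Q)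
    · exact Or.inr (hφ_neg σ hσ Q)
  have hcard : Nat.card (geomTorsion W ((3 : ℕ) : ℤ)) = 9 := by
    have := natCard_torsionBy_geomPoints (W := W) (n := ((3 : ℕ) : ℤ)) (by norm_num)
    simpa using this
  haveI : Finite (geomTorsion W ((3 : ℕ) : ℤ)) := Nat.finite_of_card_ne_zero (by rw [hcard]; norm_num)
  haveI : Nontrivial (geomTorsion W ((3 : ℕ) : ℤ)) := (Finite.one_lt_card_iff_nontrivial).mp (by rw [hcard]; norm_num)
  have h3 : ∀ R : geomTorsion W ((3 : ℕ) : ℤ), 3 • R = 0 := fun R ↦ AddSubgroup.torsionBy.nsmul R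
  have hframe : ∀ P : geomTorsion W ((3 : ℕ) : ℤ), P ≠ 0 → ∃ Q : geomTorsion W ((3 : ℕ) : ℤ), Q ≠ 0 ∧ Q ≠ P ∧ Q ≠ 2 • P := by
    intro P _
    haveI : Fintype (geomTorsion W ((3 : ℕ) : ℤ)) := Fintype.ofFinite _
    have hlt : (({0, P, 2 • P} : Finset (geomTorsion W ((3 : ℕ) : ℤ)))).card <
        (Finset.univ : Finset (geomTorsion W ((3 : ℕ) : ℤ))).card := by
      rw [Finset.card_univ, ← Nat.card_eq_fintype_card, hcard]
      exact lt_of_le_of_lt Finset.card_le_three (by norm_num)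
    obtain ⟨Q, -, hQ⟩ := Finset.exists_mem_notMem_of_card_lt_card hlt
    simp only [Finset.mem_insert, Finset.mem_singleton, not_or] at hQ
    exact ⟨Q, hQ.1, hQ.2.1, hQ.2.2⟩
  have hframeMap : ∀ P Q : geomTorsion W ((3 : ℕ) : ℤ), P ≠ 0 → Q ≠ 0 → Q ≠ P → Q ≠ 2 • P →
      ∃ L : ZMod 3 × ZMod 3 → geomTorsion W ((3 : ℕ) : ℤ), (∀ xy, L xy = xy.1.val • P + xy.2.val • Q) ∧
        (∀ xy, (L xy : geomPoints W) = xy.1.val • (P : geomPoints W) + xy.2.val • (Q : geomPoints W)) ∧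
        (∀ xy zw, L (xy + zw) = L xy + L zw) ∧ Function.Bijective L := by
    intro P Q hP hQ0 hQ1 hQ2
    let L : ZMod 3 × ZMod 3 → geomTorsion W ((3 : ℕ) : ℤ) := fun xy ↦ xy.1.val • P + xy.2.val • Q
    have hL : ∀ xy, (L xy : geomPoints W) =
        xy.1.val • (P : geomPoints W) + xy.2.val • (Q : geomPoints W) := fun xy ↦ by
      simp only [L, AddSubgroup.coe_add, AddSubgroupClass.coe_nsmul]
    have hLadd : ∀ xy zw, L (xy + zw) = L xy + L zw := fun xy zw ↦ by
      apply Subtype.ext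
      simp only [L, AddSubgroup.coe_add, AddSubgroupClass.coe_nsmul]
      exact Summit.BirchSwinnertonDyer.Rank1Residual.X9.val_smul_frame_add W P.2 Q.2 xy zw
    have hLzero : ∀ xy, L xy = 0 → xy = 0 := fun xy hxy ↦ by
      obtain ⟨ha, hb⟩ := frame_eq_zero_of_not_mem_line (h3 P) (h3 Q) hP hQ0 hQ1 hQ2
        (ZMod.val_lt xy.1) (ZMod.val_lt xy.2) hxy
      exact Prod.ext ((ZMod.val_eq_zero _).mp ha) ((ZMod.val_eq_zero _).mp hb)
    have hLinj : Function.Injective L := fun xy zw hEq ↦ by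
      have hsub : L (xy - zw) = 0 := by
        have := hLadd (xy - zw) zw
        rw [sub_add_cancel] at this
        rw [hEq] at this
        exact (add_eq_right.mp this.symm)
      exact sub_eq_zero.mp (hLzero _ hsub)
    have hLbij : Function.Bijective L := by
      refine hLinj.bijective_of_nat_card_le ?_
      rw [hcard, Nat.card_prod, Nat.card_zmod]
    exact ⟨L, fun _ ↦ rfl, hL, hLadd, hLbij⟩
  -- CLAIM A: `φ` preserves lines — `φ P = a • P` with `a ∈ (ℤ/3)^×`
  have hline : ∀ P : geomTorsion W ((3 : ℕ) : ℤ), P ≠ 0 → ∃ a : ZMod 3, a ≠ 0 ∧ φ P = a.val • P := by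
    intro P hP
    obtain ⟨Q, hQ0, hQ1, hQ2⟩ := hframe P hP
    obtain ⟨L, hLdef, hL, hLadd, hLbij⟩ := hframeMap P Q hP hQ0 hQ1 hQ2
    obtain ⟨σ, hσP, hσQ⟩ :=
      Summit.BirchSwinnertonDyer.Rank1Residual.X9.exists_smul_eq_shear_of_hasSurjectiveModNGaloisRep W (m := 3)
      (by norm_num) hsurj P.2 Q.2 L hL hLbij
    have hσP' : σ • P = P := Subtype.ext (by rw [AddSubgroup.torsionBy.coe_smul]; exact hσP)
    have hσQ' : σ • Q = P + Q :=
      Subtype.ext (by rw [AddSubgroup.torsionBy.coe_smul, AddSubgroup.coe_add]; exact hσQ)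
    obtain ⟨⟨a, b⟩, hab⟩ := hLbij.2 (φ P)
    have hσL : σ • L (a, b) = L (a + b, b) := by
      have h1 : L (a + b, b) = L (a, b) + L (b, 0) := by
        rw [← hLadd, Prod.mk_add_mk, add_zero]
      rw [h1, hLdef, hLdef, smul_add, smul_comm σ a.val P, smul_comm σ b.val Q, hσP', hσQ',
        nsmul_add, show (b, (0 : ZMod 3)).1 = b from rfl, show (b, (0 : ZMod 3)).2 = 0 from rfl,
        ZMod.val_zero, zero_nsmul, add_zero]
      abel
    rcases hφ σ P with hrel | hrel
    · -- sign `+`: `L (a, b) = L (a + b, b)`, so `b = 0`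
      rw [hσP', ← hab, hσL] at hrel
      have hb : b = 0 := by
        have := (Prod.ext_iff.mp (hLbij.1 hrel)).1
        simpa using this
      subst hb
      refine ⟨a, ?_, ?_⟩
      · rintro rfl
        have h0 : φ P = 0 := by
          rw [← hab, hLdef]
          simp
        exact hP (φ.map_eq_zero_iff.mp h0)
      · rw [← hab, hLdef]
        simp
    · -- sign `−`: `L (a, b) = -L (a + b, b)`, so `(a, b) = 0` and `φ P = 0`
      exfalso
      rw [hσP', ← hab, hσL] at hrel
      have hsum : L ((a, b) + (a + b, b)) = 0 := by
        rw [hLadd, hrel, neg_add_cancel]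
      have h0 : (a, b) + (a + b, b) = 0 := by
        have := hLbij.1 (hsum.trans (show (0 : geomTorsion W ((3 : ℕ) : ℤ)) = L 0 by rw [hLdef]; simp))
        exact this
      have key : ∀ a b : ZMod 3, (a, b) + (a + b, b) = 0 → a = 0 ∧ b = 0 := by decide
      have hab0 : a = 0 ∧ b = 0 := key a b h0
      obtain ⟨rfl, rfl⟩ := hab0
      have hφP : φ P = 0 := by rw [← hab, hLdef]; simp
      exact hP (φ.map_eq_zero_iff.mp hφP)
  -- CLAIM B: contradiction at `σ₀`
  obtain ⟨P, hP⟩ := exists_ne (0 : geomTorsion W ((3 : ℕ) : ℤ))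
  obtain ⟨a, ha, haP⟩ := hline P hP
  set R : geomTorsion W ((3 : ℕ) : ℤ) := σ₀ • P with hR
  have hR0 : R ≠ 0 := by
    intro h0
    apply hP
    have : σ₀⁻¹ • R = P := by rw [hR, smul_smul, inv_mul_cancel, one_smul]
    rw [← this, h0, smul_zero]
  have hφR : φ R = -(a.val • R) := by
    rw [hR, hφ_neg σ₀ hσ₀ P, haP, smul_comm σ₀ a.val P]
  by_cases hRline : R ≠ P ∧ R ≠ 2 • P
  · -- `(P, R)` is a frame: compare `φ (P + R)` two ways
    obtain ⟨L, hLdef, -, hLadd, hLbij⟩ := hframeMap P R hP hR0 hRline.1 hRline.2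
    have hPR0 : P + R ≠ 0 := by
      intro h0
      have : L (1, 1) = 0 := by
        rw [hLdef, show ((1 : ZMod 3), (1 : ZMod 3)).1 = 1 from rfl,
          show ((1 : ZMod 3), (1 : ZMod 3)).2 = 1 from rfl, show (1 : ZMod 3).val = 1 from rfl,
          one_nsmul, one_nsmul, h0]
      have h' := hLbij.1 (this.trans (show (0 : geomTorsion W ((3 : ℕ) : ℤ)) = L 0 by rw [hLdef]; simp))
      exact absurd h' (by decide)
    obtain ⟨c, hc, hcPR⟩ := hline (P + R) hPR0
    have h1 : φ (P + R) = L (a, -a) := by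
      have hsplit : L (a, -a) + L (0, a) = L (a, 0) := by
        rw [← hLadd]
        congr 1
        ext <;> simp
      rw [map_add, haP, hφR, eq_sub_of_add_eq hsplit, hLdef, hLdef]
      simp [sub_eq_add_neg]
    have h2 : φ (P + R) = L (c, c) := by
      rw [hcPR, hLdef, nsmul_add]
    have h12 : ((a, -a) : ZMod 3 × ZMod 3) = (c, c) := hLbij.1 (h1.symm.trans h2)
    have hac : a = c ∧ -a = c := by simpa [Prod.ext_iff] using h12
    have key : ∀ a c : ZMod 3, a ≠ 0 → a = c → -a = c → False := by decide
    exact key a c ha hac.1 hac.2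
  · -- `R` lies on the line of `P`: `R = P` or `R = 2 • P`, and then `φ R = a • R`
    have hR' : R = P ∨ R = 2 • P := by
      by_contra hcon
      exact hRline ⟨fun h ↦ hcon (Or.inl h), fun h ↦ hcon (Or.inr h)⟩
    have hφR' : φ R = a.val • R := by
      rcases hR' with h | h
      · rw [h, haP]
      · rw [h, map_nsmul, haP, smul_comm]
    have hneg : a.val • R = -(a.val • R) := hφR'.symm.trans hφR
    have h3aR : 3 • (a.val • R) = 0 := by rw [smul_comm, h3 R, smul_zero]
    exact val_nsmul_ne_zero (h3 R) hR0 ha (eq_zero_of_eq_neg h3aR hneg)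

/-- **The same with `d < 0`**: complex conjugation negates `√d`
(`smul_geomSqrt_eq_neg_of_isComplexConjugation`, from `exists_isComplexConjugation`), so an
equivariant `E^{(d)}[3] ≃+ E[3]` with `d < 0` makes `ρ̄_{E,3}` NOT surjective.
[cite: Serre1972, §4.5] [cite: SilvermanAEC2009, X.5 Cor. 5.4] -/
theorem not_hasSurjectiveModNGaloisRep_three_of_selfTwist_of_neg (W : WeierstrassCurve ℚ)
    [W.IsElliptic] {d : ℚ} (hd : d < 0)
    (he : ∃ e : geomTorsion (W.quadraticTwist d) ((3 : ℕ) : ℤ) ≃+ geomTorsion W ((3 : ℕ) : ℤ),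
      ∀ (σ : absoluteGaloisGroup ℚ) (Q : geomTorsion (W.quadraticTwist d) ((3 : ℕ) : ℤ)),
        e (σ • Q) = σ • e Q) :
    ¬ W.HasSurjectiveModNGaloisRep ((3 : ℕ) : ℤ) := by
  obtain ⟨c, hc⟩ := exists_isComplexConjugation (Rat.castHom ℝ)
  exact not_hasSurjectiveModNGaloisRep_three_of_selfTwist W hd.ne
    ⟨c, Rank1Residual.smul_geomSqrt_eq_neg_of_isComplexConjugation hd hc⟩ he

/-! ### §3 The eleven newform-partnered item-4 pairs @ 3: `ρ̄_{E,3}` is NOT onto (kernel) -/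

/-- **`414050ca1`: `ρ̄_{E,3}` NOT onto** (Cremona model `[1, -1, 0, -2007560242, 34736666216916]`; self-twist by `d_K = −91`, kernel certificate `selfTwistThree_c414050ca1`, p512219).
[cite: Fisher2012Hessian, Thm. 13.2 (n = 3)] [cite: Serre1972, §4.5] [cite: Cremona2006, Table 1 (Cremona label 414050ca1)] -/
theorem not_surj_three_c414050ca1 (W : WeierstrassCurve ℚ) [W.IsElliptic] (hW : W = ⟨1, -1, 0, -2007560242, 34736666216916⟩) :
    ¬ W.HasSurjectiveModNGaloisRep ((3 : ℕ) : ℤ) :=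
  not_hasSurjectiveModNGaloisRep_three_of_selfTwist_of_neg W (d := -91) (by norm_num) (selfTwistThree_c414050ca1 W hW)

/-- **`314678ca1`: `ρ̄_{E,3}` NOT onto** (Cremona model `[1, -1, 1, 56847512, -24780487637]`, `r_an = 1`; self-twist by `d_K = −91`, kernel certificate `selfTwistThree_c314678ca1`, p512219).
[cite: Fisher2012Hessian, Thm. 13.2 (n = 3)] [cite: Serre1972, §4.5] [cite: Cremona2006, Table 1 (Cremona label 314678ca1)] -/
theorem not_surj_three_c314678ca1 (W : WeierstrassCurve ℚ) [W.IsElliptic] (hW : W = ⟨1, -1, 1, 56847512, -24780487637⟩) :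
    ¬ W.HasSurjectiveModNGaloisRep ((3 : ℕ) : ℤ) :=
  not_hasSurjectiveModNGaloisRep_three_of_selfTwist_of_neg W (d := -91) (by norm_num) (selfTwistThree_c314678ca1 W hW)

/-- **`219040i1`: `ρ̄_{E,3}` NOT onto** (Cremona model `[0, 0, 0, 50653, 138687914]`; self-twist by `d_K = −148`, kernel certificate `selfTwistThree_c219040i1`, p512219).
[cite: Fisher2012Hessian, Thm. 13.2 (n = 3)] [cite: Serre1972, §4.5] [cite: Cremona2006, Table 1 (Cremona label 219040i1)] -/
theorem not_surj_three_c219040i1 (W : WeierstrassCurve ℚ) [W.IsElliptic] (hW : W = ⟨0, 0, 0, 50653, 138687914⟩) :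
    ¬ W.HasSurjectiveModNGaloisRep ((3 : ℕ) : ℤ) :=
  not_hasSurjectiveModNGaloisRep_three_of_selfTwist_of_neg W (d := -148) (by norm_num) (selfTwistThree_c219040i1 W hW)

/-- **`270494e1`: `ρ̄_{E,3}` NOT onto** (Cremona model `[1, -1, 1, -392128, 94695459]`; self-twist by `d_K = −139`, kernel certificate `selfTwistThree_c270494e1`, p512219).
[cite: Fisher2012Hessian, Thm. 13.2 (n = 3)] [cite: Serre1972, §4.5] [cite: Cremona2006, Table 1 (Cremona label 270494e1)] -/
theorem not_surj_three_c270494e1 (W : WeierstrassCurve ℚ) [W.IsElliptic] (hW : W = ⟨1, -1, 1, -392128, 94695459⟩) :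
    ¬ W.HasSurjectiveModNGaloisRep ((3 : ℕ) : ℤ) :=
  not_hasSurjectiveModNGaloisRep_three_of_selfTwist_of_neg W (d := -139) (by norm_num) (selfTwistThree_c270494e1 W hW)

/-- **`314678bz1`: `ρ̄_{E,3}` NOT onto** (Cremona model `[1, -1, 1, -2238606, -1287188899]`; self-twist by `d_K = −91`, kernel certificate `selfTwistThree_c314678bz1`, p512219).
[cite: Fisher2012Hessian, Thm. 13.2 (n = 3)] [cite: Serre1972, §4.5] [cite: Cremona2006, Table 1 (Cremona label 314678bz1)] -/
theorem not_surj_three_c314678bz1 (W : WeierstrassCurve ℚ) [W.IsElliptic] (hW : W = ⟨1, -1, 1, -2238606, -1287188899⟩) :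
    ¬ W.HasSurjectiveModNGaloisRep ((3 : ℕ) : ℤ) :=
  not_hasSurjectiveModNGaloisRep_three_of_selfTwist_of_neg W (d := -91) (by norm_num) (selfTwistThree_c314678bz1 W hW)

/-- **`314678cc1`: `ρ̄_{E,3}` NOT onto** (Cremona model `[1, -1, 1, 1160153, 71914847]`; self-twist by `d_K = −91`, kernel certificate `selfTwistThree_c314678cc1`, p512219).
[cite: Fisher2012Hessian, Thm. 13.2 (n = 3)] [cite: Serre1972, §4.5] [cite: Cremona2006, Table 1 (Cremona label 314678cc1)] -/
theorem not_surj_three_c314678cc1 (W : WeierstrassCurve ℚ) [W.IsElliptic] (hW : W = ⟨1, -1, 1, 1160153, 71914847⟩) :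
    ¬ W.HasSurjectiveModNGaloisRep ((3 : ℕ) : ℤ) :=
  not_hasSurjectiveModNGaloisRep_three_of_selfTwist_of_neg W (d := -91) (by norm_num) (selfTwistThree_c314678cc1 W hW)

/-- **`314678r1`: `ρ̄_{E,3}` NOT onto** (Cremona model `[1, -1, 0, -13246, -582828]`; self-twist by `d_K = −91`, kernel certificate `selfTwistThree_c314678r1`, p512219).
[cite: Fisher2012Hessian, Thm. 13.2 (n = 3)] [cite: Serre1972, §4.5] [cite: Cremona2006, Table 1 (Cremona label 314678r1)] -/
theorem not_surj_three_c314678r1 (W : WeierstrassCurve ℚ) [W.IsElliptic] (hW : W = ⟨1, -1, 0, -13246, -582828⟩) :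
    ¬ W.HasSurjectiveModNGaloisRep ((3 : ℕ) : ℤ) :=
  not_hasSurjectiveModNGaloisRep_three_of_selfTwist_of_neg W (d := -91) (by norm_num) (selfTwistThree_c314678r1 W hW)

/-- **`378560fp1`: `ρ̄_{E,3}` NOT onto** (Cremona model `[0, 0, 0, -5032087892, -127118829942624]`; self-twist by `d_K = −52`, kernel certificate `selfTwistThree_c378560fp1`, p512219).
[cite: Fisher2012Hessian, Thm. 13.2 (n = 3)] [cite: Serre1972, §4.5] [cite: Cremona2006, Table 1 (Cremona label 378560fp1)] -/
theorem not_surj_three_c378560fp1 (W : WeierstrassCurve ℚ) [W.IsElliptic] (hW : W = ⟨0, 0, 0, -5032087892, -127118829942624⟩) :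
    ¬ W.HasSurjectiveModNGaloisRep ((3 : ℕ) : ℤ) :=
  not_hasSurjectiveModNGaloisRep_three_of_selfTwist_of_neg W (d := -52) (by norm_num) (selfTwistThree_c378560fp1 W hW)

/-- **`430528v1`: `ρ̄_{E,3}` NOT onto** (Cremona model `[0, 0, 0, -13516, -599664]`; self-twist by `d_K = −31`, kernel certificate `selfTwistThree_c430528v1`, p512219).
[cite: Fisher2012Hessian, Thm. 13.2 (n = 3)] [cite: Serre1972, §4.5] [cite: Cremona2006, Table 1 (Cremona label 430528v1)] -/
theorem not_surj_three_c430528v1 (W : WeierstrassCurve ℚ) [W.IsElliptic] (hW : W = ⟨0, 0, 0, -13516, -599664⟩) :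
    ¬ W.HasSurjectiveModNGaloisRep ((3 : ℕ) : ℤ) :=
  not_hasSurjectiveModNGaloisRep_three_of_selfTwist_of_neg W (d := -31) (by norm_num) (selfTwistThree_c430528v1 W hW)

/-- **`430528y1`: `ρ̄_{E,3}` NOT onto** (Cremona model `[0, 0, 0, -12988876, 17864590224]`; self-twist by `d_K = −31`, kernel certificate `selfTwistThree_c430528y1`, p512219).
[cite: Fisher2012Hessian, Thm. 13.2 (n = 3)] [cite: Serre1972, §4.5] [cite: Cremona2006, Table 1 (Cremona label 430528y1)] -/
theorem not_surj_three_c430528y1 (W : WeierstrassCurve ℚ) [W.IsElliptic] (hW : W = ⟨0, 0, 0, -12988876, 17864590224⟩) :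
    ¬ W.HasSurjectiveModNGaloisRep ((3 : ℕ) : ℤ) :=
  not_hasSurjectiveModNGaloisRep_three_of_selfTwist_of_neg W (d := -31) (by norm_num) (selfTwistThree_c430528y1 W hW)

/-- **`481888n1`: `ρ̄_{E,3}` NOT onto** (Cremona model `[0, 0, 0, -16465, -804972]`; self-twist by `d_K = −148`, kernel certificate `selfTwistThree_c481888n1`, p512219).
[cite: Fisher2012Hessian, Thm. 13.2 (n = 3)] [cite: Serre1972, §4.5] [cite: Cremona2006, Table 1 (Cremona label 481888n1)] -/
theorem not_surj_three_c481888n1 (W : WeierstrassCurve ℚ) [W.IsElliptic] (hW : W = ⟨0, 0, 0, -16465, -804972⟩) :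
    ¬ W.HasSurjectiveModNGaloisRep ((3 : ℕ) : ℤ) :=
  not_hasSurjectiveModNGaloisRep_three_of_selfTwist_of_neg W (d := -148) (by norm_num) (selfTwistThree_c481888n1 W hW)

end Summit.BirchSwinnertonDyer.BirchSwinnertonDyer.Theorems.SmallImageSelfTwist

end
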